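import Summits.AtomisticToContinuum.FouriersLaw.Theses.HoelderEscapeProfile

/-!
# `LocalEnergyHalfHoelder` (stmt-AtomisticToContinuum-16008): an algebraic tail slower than
# `t^{-1/2}` is exactly what the conclusion forbids (kill-criterion lemma)

Negative-side support (refuter / crux disprover, 2026-08-17), companion of
`FrozenFlowExcluded.abelMean_shape_false_for_atom` (the case `α = 0`). If the on-site energy
autocovariance has a tail `S(0,t) ≥ a t^{-α}` for `t ≥ t₀` with `a > 0` and `α < ½` (any real
`α < ½`, negative values = growing profiles included; and `S` bounded
below near `0`, and Abel-integrable as the crux's guard asks), then the Abel means obey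
`Ψ(ν) = ν∫₀^∞e^{-νt}S(0,t)dt ≥ (a e^{-1}/(1-α)) ν^α - O(ν)` (`abel_lower_of_tail`, Laplace lower
bound on the window `t ≤ 1/ν`), hence NO `C, ν₀` give `Ψ(ν) ≤ C√ν` on `(0, ν₀]`
(`not_halfHoelder_of_slow_tail`). This is the precise form in which the one substantive threat
identified by the disprover — rare hot lumps (thermal breathers) with lifetimes growing faster than
`e^{2E/T}`, giving `S(0,t) ≳ t^{-1/c}`, `c > 2` — would refute K1. Pure real analysis; no statement
of the route is asserted.
-/

noncomputable section

open MeasureTheory Filter Set Topology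

namespace Summit.AtomisticToContinuum.FouriersLaw.Theorems.LocalEnergyHalfHoelder.Negative.SlowTailExcluded

/-- **Laplace lower bound for an algebraic tail.** If `S ≥ a t^{-α}` on `[t₀, ∞)` (`a ≥ 0`, `α < 1`),
`S ≥ -B` on `(0, ∞)` and `e^{-νt}S` is integrable on `(0,∞)`, then for `0 < ν ≤ 1/t₀`:
`ν∫₀^∞ e^{-νt}S ≥ (a e^{-1}/(1-α))(ν^α - ν t₀^{1-α}) - B t₀ ν`. [folklore] -/
theorem abel_lower_of_tail {S : ℝ → ℝ} {a t₀ α B ν : ℝ} (ha : 0 ≤ a) (ht₀ : 0 < t₀) (hα1 : α < 1)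
    (hB : 0 ≤ B) (hS : ∀ t, t₀ ≤ t → a * t ^ (-α) ≤ S t) (hlow : ∀ t, 0 < t → -B ≤ S t)
    (hν : 0 < ν) (hνt : ν ≤ 1 / t₀)
    (hint : IntegrableOn (fun t => Real.exp (-(ν * t)) * S t) (Ioi 0)) :
    a * Real.exp (-1) / (1 - α) * (ν ^ α - ν * t₀ ^ (1 - α)) - B * t₀ * ν ≤
      ν * ∫ t in Ioi (0:ℝ), Real.exp (-(ν * t)) * S t := by
  set f : ℝ → ℝ := fun t => Real.exp (-(ν * t)) * S t with hf
  set T : ℝ := 1 / ν with hT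
  have hTt : t₀ ≤ T := by
    rw [hT, le_div_iff₀ hν]
    calc t₀ * ν ≤ t₀ * (1 / t₀) := mul_le_mul_of_nonneg_left hνt ht₀.le
      _ = 1 := by field_simp
  have hTpos : 0 < T := by positivity
  -- split (0, ∞) = (0, t₀] ∪ (t₀, ∞)
  have hsplit : ∫ t in Ioi (0:ℝ), f t = (∫ t in Ioc (0:ℝ) t₀, f t) + ∫ t in Ioi t₀, f t := by
    rw [← setIntegral_union (Ioc_disjoint_Ioi le_rfl) measurableSet_Ioi
      (hint.mono_set Ioc_subset_Ioi_self) (hint.mono_set (Ioi_subset_Ioi ht₀.le)),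
      Ioc_union_Ioi_eq_Ioi ht₀.le]
  -- piece 1: ≥ -B t₀
  have h1 : -B * t₀ ≤ ∫ t in Ioc (0:ℝ) t₀, f t := by
    have hc : ∫ _ in Ioc (0:ℝ) t₀, (-B) = -B * t₀ := by
      rw [setIntegral_const, Real.volume_real_Ioc_of_le ht₀.le, smul_eq_mul]
      ring
    rw [← hc]
    refine setIntegral_mono_on (integrableOn_const (by simp [Real.volume_Ioc])) (hint.mono_set Ioc_subset_Ioi_self)
      measurableSet_Ioc fun t ht => ?_
    have he : 0 < Real.exp (-(ν * t)) := Real.exp_pos _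
    have he1 : Real.exp (-(ν * t)) ≤ 1 := by
      rw [Real.exp_le_one_iff]; nlinarith [ht.1]
    have hSt := hlow t ht.1
    show -B ≤ Real.exp (-(ν * t)) * S t
    rcases le_or_gt 0 (S t) with hs | hs
    · nlinarith [mul_nonneg he.le hs]
    · nlinarith [mul_le_mul_of_nonpos_right he1 hs.le]
  -- piece 2: ≥ ∫_{(t₀, T]} e^{-1} a t^{-α}
  have hnonneg : ∀ t, t₀ < t → 0 ≤ f t := by
    intro t ht
    have h0 : 0 ≤ a * t ^ (-α) := mul_nonneg ha (Real.rpow_nonneg (by linarith) _)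
    exact mul_nonneg (Real.exp_pos _).le (h0.trans (hS t ht.le))
  have hg_cont : ContinuousOn (fun t : ℝ => a * Real.exp (-1) * t ^ (-α)) (Icc t₀ T) := by
    refine ContinuousOn.mul continuousOn_const ?_
    exact ContinuousOn.rpow_const continuousOn_id fun t ht => Or.inl (lt_of_lt_of_le ht₀ ht.1).ne'
  have hg_int : IntegrableOn (fun t : ℝ => a * Real.exp (-1) * t ^ (-α)) (Ioc t₀ T) :=
    (hg_cont.integrableOn_Icc).mono_set Ioc_subset_Icc_self
  have h2a : ∫ t in Ioc t₀ T, a * Real.exp (-1) * t ^ (-α) ≤ ∫ t in Ioc t₀ T, f t := by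
    refine setIntegral_mono_on hg_int ((hint.mono_set (Ioi_subset_Ioi ht₀.le)).mono_set Ioc_subset_Ioi_self)
      measurableSet_Ioc fun t ht => ?_
    have htpos : 0 < t := ht₀.trans ht.1
    have hexp : Real.exp (-1) ≤ Real.exp (-(ν * t)) := by
      rw [Real.exp_le_exp]
      have : ν * t ≤ ν * T := mul_le_mul_of_nonneg_left ht.2 hν.le
      have hνT : ν * T = 1 := by rw [hT]; field_simp
      linarith
    have hr : 0 ≤ t ^ (-α) := Real.rpow_nonneg htpos.le _
    calc a * Real.exp (-1) * t ^ (-α) ≤ a * Real.exp (-(ν * t)) * t ^ (-α) := by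
          gcongr
      _ = Real.exp (-(ν * t)) * (a * t ^ (-α)) := by ring
      _ ≤ Real.exp (-(ν * t)) * S t :=
          mul_le_mul_of_nonneg_left (hS t ht.1.le) (Real.exp_pos _).le
  have h2b : ∫ t in Ioc t₀ T, f t ≤ ∫ t in Ioi t₀, f t :=
    setIntegral_mono_set (hint.mono_set (Ioi_subset_Ioi ht₀.le))
      ((ae_restrict_iff' measurableSet_Ioi).mpr (Eventually.of_forall fun t ht => hnonneg t ht))
      (Eventually.of_forall Ioc_subset_Ioi_self)
  -- evaluate the power integral
  have h2c : ∫ t in Ioc t₀ T, a * Real.exp (-1) * t ^ (-α) =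
      a * Real.exp (-1) * ((T ^ (-α + 1) - t₀ ^ (-α + 1)) / (-α + 1)) := by
    rw [← intervalIntegral.integral_of_le hTt, intervalIntegral.integral_const_mul,
      integral_rpow (Or.inl (by linarith))]
  -- assemble
  have hI : a * Real.exp (-1) * ((T ^ (-α + 1) - t₀ ^ (-α + 1)) / (-α + 1)) - B * t₀ ≤
      ∫ t in Ioi (0:ℝ), f t := by
    rw [hsplit]; linarith [h1, h2a, h2b, h2c]
  have hνT : ν * T ^ (-α + 1) = ν ^ α := by
    rw [hT, one_div, Real.inv_rpow hν.le, ← Real.rpow_neg hν.le, neg_add, neg_neg]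
    rw [show ν * ν ^ (α + -1) = ν ^ (1:ℝ) * ν ^ (α + -1) by rw [Real.rpow_one], ← Real.rpow_add hν]
    ring_nf
  have hfinal := mul_le_mul_of_nonneg_left hI hν.le
  have h1α : (0:ℝ) < 1 - α := by linarith
  calc a * Real.exp (-1) / (1 - α) * (ν ^ α - ν * t₀ ^ (1 - α)) - B * t₀ * ν
        = ν * (a * Real.exp (-1) * ((T ^ (-α + 1) - t₀ ^ (-α + 1)) / (-α + 1)) - B * t₀) := by
          rw [show (1:ℝ) - α = -α + 1 by ring] at *
          rw [← hνT]
          field_simp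
    _ ≤ ν * ∫ t in Ioi (0:ℝ), f t := hfinal

/-- **A tail slower than `t^{-1/2}` refutes the conclusion shape of K1.** [folklore] -/
theorem not_halfHoelder_of_slow_tail {S : ℝ → ℝ} {a t₀ α B : ℝ} (ha : 0 < a) (ht₀ : 0 < t₀)
    (hα : α < 1 / 2) (hB : 0 ≤ B)
    (hS : ∀ t, t₀ ≤ t → a * t ^ (-α) ≤ S t) (hlow : ∀ t, 0 < t → -B ≤ S t)
    (hint : ∀ ν : ℝ, 0 < ν → IntegrableOn (fun t => Real.exp (-(ν * t)) * S t) (Ioi 0)) :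
    ¬ ∃ C ν₀ : ℝ, 0 < ν₀ ∧ ∀ ν : ℝ, 0 < ν → ν ≤ ν₀ →
        ν * ∫ t in Ioi (0:ℝ), Real.exp (-(ν * t)) * S t ≤ C * Real.sqrt ν := by
  rintro ⟨C, ν₀, hν₀, hC⟩
  set K : ℝ := a * Real.exp (-1) / (1 - α) with hK
  set L : ℝ := K * t₀ ^ (1 - α) + B * t₀ with hL
  have hKpos : 0 < K := by
    have : (0:ℝ) < 1 - α := by linarith
    positivity
  -- the function ν ↦ K - L ν^{1-α} - C ν^{1/2-α} tends to K > 0 as ν ↓ 0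
  have hpow : ∀ s : ℝ, 0 < s → Tendsto (fun ν : ℝ => ν ^ s) (𝓝[>] 0) (𝓝 0) := by
    intro s hs
    have h := (Real.continuousAt_rpow_const (0:ℝ) s (Or.inr hs.le)).tendsto
    rw [Real.zero_rpow hs.ne'] at h
    exact tendsto_nhdsWithin_of_tendsto_nhds h
  have hlim : Tendsto (fun ν : ℝ => K - L * ν ^ (1 - α) - C * ν ^ (1 / 2 - α)) (𝓝[>] 0) (𝓝 K) := by
    have h1 := (hpow (1 - α) (by linarith)).const_mul L
    have h2 := (hpow (1 / 2 - α) (by linarith)).const_mul C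
    have := (tendsto_const_nhds (x := K)).sub h1 |>.sub h2
    simpa using this
  have hev : ∀ᶠ ν in 𝓝[>] (0:ℝ), K / 2 < K - L * ν ^ (1 - α) - C * ν ^ (1 / 2 - α) :=
    hlim.eventually (lt_mem_nhds (by linarith))
  have hev2 : ∀ᶠ ν in 𝓝[>] (0:ℝ), ν ∈ Ioc (0:ℝ) (min ν₀ (1 / t₀)) :=
    Ioc_mem_nhdsGT (lt_min hν₀ (by positivity))
  obtain ⟨ν, hν1, hν2⟩ := (hev.and hev2).exists
  have hν : 0 < ν := hν2.1
  have hνν₀ : ν ≤ ν₀ := hν2.2.trans (min_le_left _ _)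
  have hνt : ν ≤ 1 / t₀ := hν2.2.trans (min_le_right _ _)
  have hlowb := abel_lower_of_tail ha.le ht₀ (by linarith) hB hS hlow hν hνt (hint ν hν)
  have hup := hC ν hν hνν₀
  -- ν^α (K - L ν^{1-α} - C ν^{1/2-α}) = K ν^α - L ν - C √ν
  have hα' : ν ^ α * ν ^ (1 - α) = ν := by
    rw [← Real.rpow_add hν]; simp
  have hs' : ν ^ α * ν ^ (1 / 2 - α) = Real.sqrt ν := by
    rw [← Real.rpow_add hν, Real.sqrt_eq_rpow]; norm_num
  have hpos : 0 < ν ^ α := Real.rpow_pos_of_pos hν _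
  have key : K * ν ^ α - L * ν - C * Real.sqrt ν > ν ^ α * (K / 2) := by
    have := mul_lt_mul_of_pos_left hν1 hpos
    have e : ν ^ α * (K - L * ν ^ (1 - α) - C * ν ^ (1 / 2 - α)) =
        K * ν ^ α - L * (ν ^ α * ν ^ (1 - α)) - C * (ν ^ α * ν ^ (1 / 2 - α)) := by ring
    rw [hα', hs'] at e
    linarith [e]
  have hKL : K * (ν ^ α - ν * t₀ ^ (1 - α)) - B * t₀ * ν = K * ν ^ α - L * ν := by
    rw [hL]; ring
  rw [hKL] at hlowb
  nlinarith [hpos, hKpos]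

end Summit.AtomisticToContinuum.FouriersLaw.Theorems.LocalEnergyHalfHoelder.Negative.SlowTailExcluded

end
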